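import Summits.QuantumAdvantage.QuantumAdvantage.Theses.ThirdFactorialPincer
import HarnessLib

/-!
# Route `ThirdFactorialPincer`, support item `PadLemma` (stmt-QuantumAdvantage-11650) — PROVED

`PadLemma`: an Eisenstein integer `a + bω` with `3 ∤ N(a + bω) = a² − ab + b²` is determined by its
associate class and its residue mod `3`: if `(c, d)` is one of the six associates
`(a,b), (−b, a−b), (b−a, −a), (−a,−b), (b, b−a), (a−b, a)` of `(a, b)` and `c ≡ a`, `d ≡ b (mod 3)`, then
`(c, d) = (a, b)`.  Proof: reduce modulo `3` and decide the finitely many cases in `(ℤ/3)²` (in each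
non-trivial case the two congruences force `3 ∣ a² − ab + b²`).  Cross-route contribution of cell B2b-1
(linnik-cubic, prover-b2b-linnik-2-g2-0); value = a closed support item, NOT summit progress.
-/

namespace Summit.QuantumAdvantage.QuantumAdvantage.Theorems.PadLemma

/-- **`PadLemma`** (stmt-QuantumAdvantage-11650): the six associates of `a + bω` are pairwise incongruent
mod `3` when `3 ∤ a² − ab + b²`. [folklore] -/
theorem padLemma_proof : Summit.QuantumAdvantage.QuantumAdvantage.Theses.ThirdFactorialPincer.PadLemma := by
  intro a b c d h3 hcases hac hbd
  have h3' : (a : ZMod 3) * (a : ZMod 3) - (a : ZMod 3) * (b : ZMod 3) + (b : ZMod 3) * (b : ZMod 3) ≠ 0 := by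
    intro h
    apply h3
    have h' : ((a * a - a * b + b * b : ℤ) : ZMod 3) = 0 := by push_cast; exact h
    exact (ZMod.intCast_zmod_eq_zero_iff_dvd _ 3).mp h'
  rcases hcases with ⟨hc, hd⟩ | ⟨hc, hd⟩ | ⟨hc, hd⟩ | ⟨hc, hd⟩ | ⟨hc, hd⟩ | ⟨hc, hd⟩
  · exact ⟨hc, hd⟩
  all_goals
    exfalso
    rw [hc] at hac
    rw [hd] at hbd
    have e1 := (ZMod.intCast_zmod_eq_zero_iff_dvd _ 3).mpr hac
    have e2 := (ZMod.intCast_zmod_eq_zero_iff_dvd _ 3).mpr hbd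
    push_cast at e1 e2
    generalize (a : ZMod 3) = x at h3' e1 e2
    generalize (b : ZMod 3) = y at h3' e1 e2
    revert x y
    decide

end Summit.QuantumAdvantage.QuantumAdvantage.Theorems.PadLemma
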